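import Summits.ValiantsHypothesis.ValiantsHypothesis.Theorems.LiftNullstellensatzLiftWidthPerFourRungOneCore
import Summits.ValiantsHypothesis.ValiantsHypothesis.Theorems.LiftNullstellensatzLiftWidthPerFourSameRow

/-!
# Route LiftNullstellensatz — `LiftWidthPerFour` (stmt-ValiantsHypothesis-5922), CASE A rung 1:
`per_4` is not a sum of `≤ 5` products of row-`i₀` quadrics by row-`i₁` quadrics (`ℓ = ℓ' = 0`)

First rung of `stub_caseA` (line `outer_layers`, format `(4,5,4)`): `caseA_zero`, `stub_caseA_zero`.
Bridge to the core `false_of_G1_blocks` (`…RungOneCore`): normalise rows to `0, 3` (row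
permutations fix `per_4`), pad to five products, apply `∂²/∂x_{0j}∂x_{3k}` and the substitution
`κ` killing rows `0, 3` and column `0`; `κ(∂²per_4)` is `G₁ = e₀ q'ᵀ + q' e₀ᵀ`, and the linear
forms `κ(∂_{0j} v_s)`, `κ(∂_{3k} v'_s)` factor it (`CASEA-RUNG1-p2.md` §1–2).  No new definitions.
VP ≠ VNP is not moved by this item.
-/

noncomputable section

open MvPolynomial Matrix Finset

namespace Summit.ValiantsHypothesis.LiftNullstellensatz

open Literature.Computability.AlgebraicComplexity
open Literature.Computability.AlgebraicComplexity.VonZurGathen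

variable {K : Type*} [Field K]

/-! ### Subpermanent toolkit (complements `VonZurGathen.pderiv_perPoly`) -/

section Subperm

variable {ι : Type*} [Fintype ι] [DecidableEq ι]

/-- `∂/∂x_{rc}` of a subpermanent of the generic matrix using row `r` and column `c` is the
subpermanent with that row and column deleted. [folklore] -/
theorem pderiv_subperm_X_mem (Rw Cl : Finset ι) {r c : ι} (hr : r ∈ Rw) (hc : c ∈ Cl) :
    pderiv (r, c) ((mvPolynomialX ι ι K).subperm (· ∈ Cl) (· ∈ Rw)) =
      (mvPolynomialX ι ι K).subperm (· ∈ Cl.erase c) (· ∈ Rw.erase r) := by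
  have hRw : (mvPolynomialX ι ι K).subperm (· ∈ Cl) (· ∈ Rw) =
      (mvPolynomialX ι ι K).subperm (· ∈ Cl) (· ∈ insert r (Rw.erase r)) :=
    (mvPolynomialX ι ι K).subperm_congr (fun _ => Iff.rfl) (fun j => by rw [Finset.insert_erase hr])
  have hterm : ∀ c', pderiv (r, c) ((mvPolynomialX ι ι K) r c' *
      (mvPolynomialX ι ι K).subperm (· ∈ Cl.erase c') (· ∈ Rw.erase r)) =
      if c' = c then (mvPolynomialX ι ι K).subperm (· ∈ Cl.erase c') (· ∈ Rw.erase r)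
      else 0 := by
    intro c'
    rw [Derivation.leibniz, pderiv_subperm_X_eq_zero _ _ (by simp), smul_zero, zero_add,
      smul_eq_mul, Matrix.mvPolynomialX_apply, pderiv_X]
    by_cases h : c' = c
    · subst h; simp
    · have hne : (r, c') ≠ (r, c) := fun e => h (Prod.mk.inj e).2
      simp [hne, h]
  rw [hRw, subperm_insert_row _ (Finset.notMem_erase r _) Cl, map_sum,
    Finset.sum_congr rfl fun c' _ => hterm c', Finset.sum_ite_eq' Cl c, if_pos hc]

/-- `∂/∂x_{rc}` kills a subpermanent of the generic matrix not using the column `c`. [folklore] -/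
theorem pderiv_subperm_X_col (p q : ι → Prop) [DecidablePred p] [DecidablePred q] {r c : ι}
    (hc : ¬ p c) : pderiv (r, c) ((mvPolynomialX ι ι K).subperm p q) = 0 := by
  unfold Matrix.subperm
  rw [map_sum]
  refine Finset.sum_eq_zero fun f _ => ?_
  rw [derivation_prod]
  refine Finset.sum_eq_zero fun i _ => ?_
  rw [Matrix.mvPolynomialX_apply, pderiv_X_of_ne, mul_zero]
  intro h
  exact hc ((Prod.mk.inj h).2 ▸ i.2)

/-- A subpermanent with a zero column vanishes. [folklore] -/
theorem subperm_eq_zero_of_col_zero {R : Type*} [CommRing R] (M : Matrix ι ι R)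
    (p q : ι → Prop) [DecidablePred p] [DecidablePred q] (c : ι) (hc : p c)
    (hM : ∀ r, q r → M r c = 0) : M.subperm p q = 0 := by
  unfold Matrix.subperm
  refine Finset.sum_eq_zero fun f _ => ?_
  exact Finset.prod_eq_zero (Finset.mem_univ ⟨c, hc⟩) (hM _ (f ⟨c, hc⟩).2)

/-- The `2 × 2` subpermanent on rows `{r₁, r₂}` and columns `{b, d}`. [folklore] -/
theorem subperm_pair_pair {R : Type*} [CommRing R] (M : Matrix ι ι R) {r₁ r₂ b d : ι}
    (hr : r₁ ≠ r₂) (hbd : b ≠ d) :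
    M.subperm (· ∈ ({b, d} : Finset ι)) (· ∈ ({r₁, r₂} : Finset ι)) =
      M r₁ b * M r₂ d + M r₁ d * M r₂ b := by
  have h1 : ({b, d} : Finset ι).erase b = {d} := by
    rw [Finset.erase_insert (by simpa using hbd)]
  have h2 : ({b, d} : Finset ι).erase d = {b} := by
    rw [Finset.pair_comm, Finset.erase_insert (by simpa using hbd.symm)]
  rw [show ({r₁, r₂} : Finset ι) = insert r₁ {r₂} from rfl,
    subperm_insert_row M (by simpa using hr) {b, d}, Finset.sum_pair hbd, h1, h2,
    subperm_singleton, subperm_singleton]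

end Subperm

/-- An element of the row ideal `(x_{r,·})`, differentiated in a variable of another row, stays in
the row ideal. [folklore] -/
theorem pderiv_mem_rowIdeal {r : Fin 4} {v : Fin 4 × Fin 4} (hv : v.1 ≠ r)
    {f : MvPolynomial (Fin 4 × Fin 4) K}
    (hf : f ∈ Ideal.span (Set.range fun j : Fin 4 => (X (r, j) : MvPolynomial (Fin 4 × Fin 4) K))) :
    pderiv v f ∈ Ideal.span (Set.range fun j : Fin 4 => (X (r, j) : MvPolynomial (Fin 4 × Fin 4) K)) := by
  obtain ⟨g, rfl⟩ := Ideal.mem_span_range_iff_exists_fun.1 hf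
  rw [map_sum]
  refine Ideal.sum_mem _ fun j _ => ?_
  rw [Derivation.leibniz, smul_eq_mul, smul_eq_mul, pderiv_X_of_ne (fun h => hv (by rw [← h])),
    mul_zero, zero_add]
  exact Ideal.mul_mem_right _ _ (Ideal.subset_span ⟨j, rfl⟩)

/-- A substitution killing the variables of row `r` kills the row ideal `(x_{r,·})`. [folklore] -/
theorem aeval_eq_zero_of_mem_rowIdeal {r : Fin 4} (g : Fin 4 × Fin 4 → MvPolynomial (Fin 4 × Fin 4) K)
    (hg : ∀ j, g (r, j) = 0) {f : MvPolynomial (Fin 4 × Fin 4) K}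
    (hf : f ∈ Ideal.span (Set.range fun j : Fin 4 => (X (r, j) : MvPolynomial (Fin 4 × Fin 4) K))) :
    aeval g f = 0 := by
  obtain ⟨c, rfl⟩ := Ideal.mem_span_range_iff_exists_fun.1 hf
  rw [map_sum]
  exact Finset.sum_eq_zero fun j _ => by rw [map_mul, aeval_X, hg, mul_zero]

/-- `κ(∂_{0j} ∂_{3k} per_4) = 0` when `j, k ≠ 0` (for `j = k` the double derivative vanishes; for
`j ≠ k` the remaining `2 × 2` subpermanent contains the killed column `0`). [folklore] -/
theorem kappa_pderiv_pderiv_perPoly_eq_zero {j k : Fin 4} (hj : j ≠ 0) (hk : k ≠ 0) :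
    aeval (fun w : Fin 4 × Fin 4 => if w.1 = 0 ∨ w.1 = 3 ∨ w.2 = 0
        then (0 : MvPolynomial (Fin 4 × Fin 4) K) else X w)
      (pderiv (0, j) (pderiv (3, k) (perPoly (Fin 4) K))) = 0 := by
  rw [pderiv_perPoly]
  have hcongr : (mvPolynomialX (Fin 4) (Fin 4) K).subperm (· ≠ k) (· ≠ (3 : Fin 4)) =
      (mvPolynomialX (Fin 4) (Fin 4) K).subperm (· ∈ Finset.univ.erase k)
        (· ∈ Finset.univ.erase (3 : Fin 4)) :=
    (mvPolynomialX (Fin 4) (Fin 4) K).subperm_congr (fun i => by simp) (fun i => by simp)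
  rw [hcongr]
  by_cases hjk : j = k
  · subst hjk
    rw [pderiv_subperm_X_col _ _ (by simp), map_zero]
  rw [pderiv_subperm_X_mem _ _ (by simp) (by simp [hjk]), aeval_subperm_X]
  exact subperm_eq_zero_of_col_zero _ _ _ 0 (by simp [hj.symm, hk.symm])
    fun r _ => if_pos (Or.inr (Or.inr rfl))

/-- `κ(∂_{00} ∂_{3k} per_4) = x_{1b} x_{2d} + x_{1d} x_{2b}` for `{k, b, d} = {1, 2, 3}`. [folklore] -/
theorem kappa_pderiv_pderiv_perPoly_eq_perm {k b d : Fin 4} (hk : k ≠ 0) (hb : b ≠ 0) (hd : d ≠ 0)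
    (hkb : k ≠ b) (hkd : k ≠ d) (hbd : b ≠ d) :
    aeval (fun w : Fin 4 × Fin 4 => if w.1 = 0 ∨ w.1 = 3 ∨ w.2 = 0
        then (0 : MvPolynomial (Fin 4 × Fin 4) K) else X w)
      (pderiv (0, 0) (pderiv (3, k) (perPoly (Fin 4) K))) =
      X (1, b) * X (2, d) + X (1, d) * X (2, b) := by
  rw [pderiv_perPoly]
  have hcongr : (mvPolynomialX (Fin 4) (Fin 4) K).subperm (· ≠ k) (· ≠ (3 : Fin 4)) =
      (mvPolynomialX (Fin 4) (Fin 4) K).subperm (· ∈ Finset.univ.erase k)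
        (· ∈ Finset.univ.erase (3 : Fin 4)) :=
    (mvPolynomialX (Fin 4) (Fin 4) K).subperm_congr (fun i => by simp) (fun i => by simp)
  rw [hcongr, pderiv_subperm_X_mem _ _ (by simp) (by simp [hk.symm]), aeval_subperm_X]
  have hcols : ∀ i : Fin 4, i ∈ (Finset.univ.erase k).erase 0 ↔ i ∈ ({b, d} : Finset (Fin 4)) := by
    intro i
    simp only [Finset.mem_erase, Finset.mem_univ, and_true, Finset.mem_insert,
      Finset.mem_singleton]
    constructor
    · rintro ⟨hi0, hik⟩
      have hi := i.isLt; have hk' := k.isLt; have hb' := b.isLt; have hd' := d.isLt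
      simp only [ne_eq, Fin.ext_iff, Fin.val_zero] at hk hb hd hkb hkd hbd hi0 hik ⊢
      omega
    · rintro (rfl | rfl)
      · exact ⟨hb, hkb.symm⟩
      · exact ⟨hd, hkd.symm⟩
  have hrows : ∀ i : Fin 4, i ∈ (Finset.univ.erase (3 : Fin 4)).erase 0 ↔
      i ∈ ({1, 2} : Finset (Fin 4)) := by
    intro i; fin_cases i <;> simp
  rw [(Matrix.of fun r c => _).subperm_congr hcols hrows,
    subperm_pair_pair _ (by decide : (1 : Fin 4) ≠ 2) hbd]
  simp [hb, hd]

/-- `κ(∂_{0k} ∂_{30} per_4) = x_{1b} x_{2d} + x_{1d} x_{2b}` for `{k, b, d} = {1, 2, 3}`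
(the transposed position). [folklore] -/
theorem kappa_pderiv_pderiv_perPoly_eq_perm' {k b d : Fin 4} (hk : k ≠ 0) (hb : b ≠ 0) (hd : d ≠ 0)
    (hkb : k ≠ b) (hkd : k ≠ d) (hbd : b ≠ d) :
    aeval (fun w : Fin 4 × Fin 4 => if w.1 = 0 ∨ w.1 = 3 ∨ w.2 = 0
        then (0 : MvPolynomial (Fin 4 × Fin 4) K) else X w)
      (pderiv (0, k) (pderiv (3, 0) (perPoly (Fin 4) K))) =
      X (1, b) * X (2, d) + X (1, d) * X (2, b) := by
  rw [pderiv_perPoly]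
  have hcongr : (mvPolynomialX (Fin 4) (Fin 4) K).subperm (· ≠ (0 : Fin 4)) (· ≠ (3 : Fin 4)) =
      (mvPolynomialX (Fin 4) (Fin 4) K).subperm (· ∈ Finset.univ.erase (0 : Fin 4))
        (· ∈ Finset.univ.erase (3 : Fin 4)) :=
    (mvPolynomialX (Fin 4) (Fin 4) K).subperm_congr (fun i => by simp) (fun i => by simp)
  rw [hcongr, pderiv_subperm_X_mem _ _ (by simp) (by simp [hk]), aeval_subperm_X]
  have hcols : ∀ i : Fin 4, i ∈ (Finset.univ.erase (0 : Fin 4)).erase k ↔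
      i ∈ ({b, d} : Finset (Fin 4)) := by
    intro i
    simp only [Finset.mem_erase, Finset.mem_univ, and_true, Finset.mem_insert,
      Finset.mem_singleton]
    constructor
    · rintro ⟨hik, hi0⟩
      have hi := i.isLt; have hk' := k.isLt; have hb' := b.isLt; have hd' := d.isLt
      simp only [ne_eq, Fin.ext_iff, Fin.val_zero] at hk hb hd hkb hkd hbd hi0 hik ⊢
      omega
    · rintro (rfl | rfl)
      · exact ⟨hkb.symm, hb⟩
      · exact ⟨hkd.symm, hd⟩
  have hrows : ∀ i : Fin 4, i ∈ (Finset.univ.erase (3 : Fin 4)).erase 0 ↔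
      i ∈ ({1, 2} : Finset (Fin 4)) := by
    intro i; fin_cases i <;> simp
  rw [(Matrix.of fun r c => _).subperm_congr hcols hrows,
    subperm_pair_pair _ (by decide : (1 : Fin 4) ≠ 2) hbd]
  simp [hb, hd]

/-! ### CASE A at `ℓ = ℓ' = 0`, rows `0` and `3`, five products -/

/-- Rows `0, 3`, five products: `per_4 ≠ Σ_{s<5} v_s v'_s` with `v_s ∈ (x_{0,·})₂`,
`v'_s ∈ (x_{3,·})₂`.  Apply `κ ∘ ∂_{0j} ∘ ∂_{3k}`: the linear forms `κ(∂_{0j} v_s)`, `κ(∂_{3k} v'_s)`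
would factor `G₁`, contradicting `false_of_G1_blocks`. [folklore] -/
theorem caseA_zero_rows03 (h2 : (2 : K) ≠ 0) (V V' : Fin 5 → MvPolynomial (Fin 4 × Fin 4) K)
    (hV : ∀ s, V s ∈ Ideal.span (Set.range fun j : Fin 4 => (X (0, j) : MvPolynomial (Fin 4 × Fin 4) K)))
    (hV2 : ∀ s, (V s).IsHomogeneous 2)
    (hV' : ∀ s, V' s ∈ Ideal.span (Set.range fun j : Fin 4 => (X (3, j) : MvPolynomial (Fin 4 × Fin 4) K)))
    (hV'2 : ∀ s, (V' s).IsHomogeneous 2)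
    (hper : perPoly (Fin 4) K = ∑ s, V s * V' s) : False := by
  classical
  set g : Fin 4 × Fin 4 → MvPolynomial (Fin 4 × Fin 4) K :=
    fun w => if w.1 = 0 ∨ w.1 = 3 ∨ w.2 = 0 then 0 else X w with hg
  set κ : MvPolynomial (Fin 4 × Fin 4) K →ₐ[K] MvPolynomial (Fin 4 × Fin 4) K := aeval g with hκ
  have hg1 : ∀ w, (g w).IsHomogeneous 1 := fun w => by
    simp only [hg]; split_ifs
    · exact isHomogeneous_zero _ _ _
    · exact isHomogeneous_X K w
  have hκV : ∀ s, κ (V s) = 0 := fun s =>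
    aeval_eq_zero_of_mem_rowIdeal g (fun j => by simp [hg]) (hV s)
  have hκV' : ∀ s, κ (V' s) = 0 := fun s =>
    aeval_eq_zero_of_mem_rowIdeal g (fun j => by simp [hg]) (hV' s)
  have hκDV : ∀ s (k : Fin 4), κ (pderiv (3, k) (V s)) = 0 := fun s k =>
    aeval_eq_zero_of_mem_rowIdeal g (fun j => by simp [hg])
      (pderiv_mem_rowIdeal (by decide : (3 : Fin 4) ≠ 0) (hV s))
  have hκDV' : ∀ s (j : Fin 4), κ (pderiv (0, j) (V' s)) = 0 := fun s j =>
    aeval_eq_zero_of_mem_rowIdeal g (fun j => by simp [hg])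
      (pderiv_mem_rowIdeal (by decide : (0 : Fin 4) ≠ 3) (hV' s))
  have key : ∀ j k : Fin 4, ∑ s, κ (pderiv (0, j) (V s)) * κ (pderiv (3, k) (V' s)) =
      κ (pderiv (0, j) (pderiv (3, k) (perPoly (Fin 4) K))) := by
    intro j k
    rw [hper, map_sum, map_sum, map_sum]
    refine Finset.sum_congr rfl fun s _ => ?_
    simp only [Derivation.leibniz, smul_eq_mul, map_add, map_mul, hκV, hκV', hκDV, hκDV', zero_mul,
      mul_zero, add_zero, zero_add]
    ring
  have hA : ∀ (j : Fin 4) s, (κ (pderiv (0, j) (V s))).IsHomogeneous 1 := fun j s =>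
    isHomogeneous_aeval_of_forall g hg1 (by simpa using (hV2 s).pderiv (i := (0, j)))
  have hC : ∀ (k : Fin 4) s, (κ (pderiv (3, k) (V' s))).IsHomogeneous 1 := fun k s =>
    isHomogeneous_aeval_of_forall g hg1 (by simpa using (hV'2 s).pderiv (i := (3, k)))
  have G0 : ∀ j k : Fin 4, j ≠ 0 → k ≠ 0 →
      κ (pderiv (0, j) (pderiv (3, k) (perPoly (Fin 4) K))) = 0 := fun j k hj hk =>
    kappa_pderiv_pderiv_perPoly_eq_zero hj hk
  refine false_of_G1_blocks h2 (Matrix.of fun i s => κ (pderiv (0, i.succ) (V s)))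
    (Matrix.of fun s i => κ (pderiv (3, i.succ) (V' s))) (fun s => κ (pderiv (0, 0) (V s)))
    (fun s => κ (pderiv (3, 0) (V' s))) (fun i s => hA _ _) (fun s i => hC _ _) ?_ ?_ ?_
  · refine Matrix.ext fun i i' => ?_
    rw [Matrix.mul_apply, Matrix.zero_apply]
    simp only [Matrix.of_apply]
    rw [key]
    exact G0 _ _ (Fin.succ_ne_zero i) (Fin.succ_ne_zero i')
  · funext i
    simp only [Matrix.mulVec, dotProduct, Matrix.of_apply]
    rw [key]
    fin_cases i
    · show κ (pderiv (0, 1) (pderiv (3, 0) (perPoly (Fin 4) K))) =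
        X (1, 2) * X (2, 3) + X (1, 3) * X (2, 2)
      exact kappa_pderiv_pderiv_perPoly_eq_perm' (k := 1) (b := 2) (d := 3) (by decide) (by decide) (by decide)
        (by decide) (by decide) (by decide)
    · show κ (pderiv (0, 2) (pderiv (3, 0) (perPoly (Fin 4) K))) =
        X (1, 1) * X (2, 3) + X (1, 3) * X (2, 1)
      exact kappa_pderiv_pderiv_perPoly_eq_perm' (k := 2) (b := 1) (d := 3) (by decide) (by decide) (by decide)
        (by decide) (by decide) (by decide)
    · show κ (pderiv (0, 3) (pderiv (3, 0) (perPoly (Fin 4) K))) =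
        X (1, 1) * X (2, 2) + X (1, 2) * X (2, 1)
      exact kappa_pderiv_pderiv_perPoly_eq_perm' (k := 3) (b := 1) (d := 2) (by decide) (by decide) (by decide)
        (by decide) (by decide) (by decide)
  · funext i
    simp only [Matrix.vecMul, dotProduct, Matrix.of_apply]
    rw [key]
    fin_cases i
    · show κ (pderiv (0, 0) (pderiv (3, 1) (perPoly (Fin 4) K))) =
        X (1, 2) * X (2, 3) + X (1, 3) * X (2, 2)
      exact kappa_pderiv_pderiv_perPoly_eq_perm (k := 1) (b := 2) (d := 3) (by decide) (by decide) (by decide)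
        (by decide) (by decide) (by decide)
    · show κ (pderiv (0, 0) (pderiv (3, 2) (perPoly (Fin 4) K))) =
        X (1, 1) * X (2, 3) + X (1, 3) * X (2, 1)
      exact kappa_pderiv_pderiv_perPoly_eq_perm (k := 2) (b := 1) (d := 3) (by decide) (by decide) (by decide)
        (by decide) (by decide) (by decide)
    · show κ (pderiv (0, 0) (pderiv (3, 3) (perPoly (Fin 4) K))) =
        X (1, 1) * X (2, 2) + X (1, 2) * X (2, 1)
      exact kappa_pderiv_pderiv_perPoly_eq_perm (k := 3) (b := 1) (d := 2) (by decide) (by decide) (by decide)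
        (by decide) (by decide) (by decide)

/-! ### Row permutations and padding -/

/-- Row permutations fix the generic permanent. [folklore] -/
theorem rename_rowPerm_perPoly (π : Equiv.Perm (Fin 4)) :
    rename (fun v : Fin 4 × Fin 4 => (π v.1, v.2)) (perPoly (Fin 4) K) = perPoly (Fin 4) K := by
  have h1 : rename (fun v : Fin 4 × Fin 4 => (π v.1, v.2)) (perPoly (Fin 4) K) =
      ((mvPolynomialX (Fin 4) (Fin 4) K).map
        (rename (fun v : Fin 4 × Fin 4 => (π v.1, v.2)))).permanent := by
    simp only [perPoly, Matrix.permanent, map_sum, map_prod, Matrix.map_apply]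
  have h2 : (mvPolynomialX (Fin 4) (Fin 4) K).map (rename (fun v : Fin 4 × Fin 4 => (π v.1, v.2))) =
      (mvPolynomialX (Fin 4) (Fin 4) K).submatrix π id := by
    ext i j; simp [Matrix.mvPolynomialX_apply, rename_X]
  rw [h1, h2, Matrix.permanent_permute_cols]; rfl

/-- **CASE A at `ℓ = ℓ' = 0`, five products**: for rows `i₀ ≠ i₁`, `per_4 ≠ Σ_{s<5} v_s v'_s` with
`v_s ∈ (x_{i₀,·})₂`, `v'_s ∈ (x_{i₁,·})₂` (reduce to rows `0, 3` by a row permutation). [folklore] -/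
theorem caseA_zero_five (h2 : (2 : K) ≠ 0) (i₀ i₁ : Fin 4) (hi : i₀ ≠ i₁)
    (V V' : Fin 5 → MvPolynomial (Fin 4 × Fin 4) K)
    (hV : ∀ s, V s ∈ Ideal.span (Set.range fun j : Fin 4 => (X (i₀, j) : MvPolynomial (Fin 4 × Fin 4) K)))
    (hV2 : ∀ s, (V s).IsHomogeneous 2)
    (hV' : ∀ s, V' s ∈ Ideal.span (Set.range fun j : Fin 4 => (X (i₁, j) : MvPolynomial (Fin 4 × Fin 4) K)))
    (hV'2 : ∀ s, (V' s).IsHomogeneous 2)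
    (hper : perPoly (Fin 4) K = ∑ s, V s * V' s) : False := by
  classical
  let σ₁ : Equiv.Perm (Fin 4) := Equiv.swap i₀ 0
  have hσ₁ : σ₁ i₁ ≠ 0 := by
    intro h
    have : σ₁ i₁ = σ₁ i₀ := by rw [h]; exact (Equiv.swap_apply_left _ _).symm
    exact hi (σ₁.injective this).symm
  let π : Equiv.Perm (Fin 4) := σ₁.trans (Equiv.swap (σ₁ i₁) 3)
  have hπ₀ : π i₀ = 0 := by
    show Equiv.swap (σ₁ i₁) 3 (σ₁ i₀) = 0
    rw [show σ₁ i₀ = 0 from Equiv.swap_apply_left _ _]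
    exact Equiv.swap_apply_of_ne_of_ne hσ₁.symm (by decide)
  have hπ₁ : π i₁ = 3 := Equiv.swap_apply_left _ _
  set ρ : MvPolynomial (Fin 4 × Fin 4) K →ₐ[K] MvPolynomial (Fin 4 × Fin 4) K :=
    rename (fun v : Fin 4 × Fin 4 => (π v.1, v.2)) with hρ
  have hρI : ∀ (r : Fin 4) (f : MvPolynomial (Fin 4 × Fin 4) K),
      f ∈ Ideal.span (Set.range fun j : Fin 4 => (X (r, j) : MvPolynomial (Fin 4 × Fin 4) K)) →
      ρ f ∈ Ideal.span (Set.range fun j : Fin 4 => (X (π r, j) : MvPolynomial (Fin 4 × Fin 4) K)) := by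
    intro r f hf
    have := Ideal.mem_map_of_mem ρ hf
    rw [Ideal.map_span] at this
    refine Ideal.span_mono ?_ this
    rintro _ ⟨_, ⟨j, rfl⟩, rfl⟩
    exact ⟨j, by simp [hρ, rename_X]⟩
  refine caseA_zero_rows03 h2 (fun s => ρ (V s)) (fun s => ρ (V' s))
    (fun s => hπ₀ ▸ hρI i₀ _ (hV s)) (fun s => (hV2 s).rename_isHomogeneous)
    (fun s => hπ₁ ▸ hρI i₁ _ (hV' s)) (fun s => (hV'2 s).rename_isHomogeneous) ?_
  calc perPoly (Fin 4) K = ρ (perPoly (Fin 4) K) := (rename_rowPerm_perPoly π).symm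
    _ = ∑ s, ρ (V s) * ρ (V' s) := by rw [hper, map_sum]; simp only [map_mul]

/-- **CASE A at `ℓ = ℓ' = 0`** (the first rung of `stub_caseA`, line `outer_layers`): for rows
`i₀ ≠ i₁` and `b ≤ 5`, `per_4` is not a sum of `b` products `v_s v'_s` of homogeneous quadrics with
`v_s ∈ (x_{i₀,0}, …, x_{i₀,3})` and `v'_s ∈ (x_{i₁,0}, …, x_{i₁,3})`.  Equivalently: `per_4` has no
homogeneous ABP of format `(4,5,4)` with row-type outer layers for two different rows
(`CASEA-RUNG1-p2.md`).  Any field with `2 ≠ 0`. [folklore] -/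
theorem caseA_zero (h2 : (2 : K) ≠ 0) (b : ℕ) (hb : b ≤ 5) (i₀ i₁ : Fin 4) (hi : i₀ ≠ i₁)
    (v v' : Fin b → MvPolynomial (Fin 4 × Fin 4) K)
    (hv : ∀ s, v s ∈ Ideal.span (Set.range fun j : Fin 4 => (X (i₀, j) : MvPolynomial (Fin 4 × Fin 4) K)))
    (hv2 : ∀ s, (v s).IsHomogeneous 2)
    (hv' : ∀ s, v' s ∈ Ideal.span (Set.range fun j : Fin 4 => (X (i₁, j) : MvPolynomial (Fin 4 × Fin 4) K)))
    (hv'2 : ∀ s, (v' s).IsHomogeneous 2) :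
    perPoly (Fin 4) K ≠ ∑ s, v s * v' s := by
  classical
  intro hper
  let V : Fin 5 → MvPolynomial (Fin 4 × Fin 4) K := fun t => if h : (t : ℕ) < b then v ⟨t, h⟩ else 0
  let V' : Fin 5 → MvPolynomial (Fin 4 × Fin 4) K := fun t => if h : (t : ℕ) < b then v' ⟨t, h⟩ else 0
  have hsum : ∑ t, V t * V' t = ∑ s, v s * v' s := by
    let f : ℕ → MvPolynomial (Fin 4 × Fin 4) K := fun n => if h : n < b then v ⟨n, h⟩ * v' ⟨n, h⟩ else 0
    have h5 : ∑ t : Fin 5, V t * V' t = ∑ n ∈ Finset.range 5, f n := by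
      rw [← Fin.sum_univ_eq_sum_range]
      refine Finset.sum_congr rfl fun t _ => ?_
      simp only [V, V', f]
      split_ifs <;> simp
    have hb' : ∑ s : Fin b, v s * v' s = ∑ n ∈ Finset.range b, f n := by
      rw [← Fin.sum_univ_eq_sum_range]
      refine Finset.sum_congr rfl fun s _ => ?_
      simp only [f, dif_pos s.isLt]
    rw [h5, hb']
    refine (Finset.sum_subset (Finset.range_subset_range.2 hb) fun n hn hnb => ?_).symm
    simp only [f, Finset.mem_range] at hnb ⊢
    rw [dif_neg hnb]
  refine caseA_zero_five h2 i₀ i₁ hi V V' (fun t => ?_) (fun t => ?_) (fun t => ?_) (fun t => ?_)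
    (by rw [hsum]; exact hper)
  all_goals simp only [V, V']
  all_goals split_ifs
  · exact hv _
  · exact Ideal.zero_mem _
  · exact hv2 _
  · exact isHomogeneous_zero _ _ _
  · exact hv' _
  · exact Ideal.zero_mem _
  · exact hv'2 _
  · exact isHomogeneous_zero _ _ _

/-- `stub_caseA` of line `outer_layers` at `ℓ = ℓ' = 0`, in the stub's own binder shape over `ℂ`
(`Ideal.span (insert 0 S) = Ideal.span S`). [folklore] -/
theorem stub_caseA_zero :
    ∀ b : ℕ, b ≤ 5 → ∀ i₀ i₁ : Fin 4, i₀ ≠ i₁ →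
      ∀ v v' : Fin b → MvPolynomial (Fin 4 × Fin 4) ℂ,
        (∀ s, v s ∈ Ideal.span (insert (0 : MvPolynomial (Fin 4 × Fin 4) ℂ)
          (Set.range fun j : Fin 4 => (X (i₀, j) : MvPolynomial (Fin 4 × Fin 4) ℂ)))) →
        (∀ s, (v s).IsHomogeneous 2) →
        (∀ s, v' s ∈ Ideal.span (insert (0 : MvPolynomial (Fin 4 × Fin 4) ℂ)
          (Set.range fun j : Fin 4 => (X (i₁, j) : MvPolynomial (Fin 4 × Fin 4) ℂ)))) →
        (∀ s, (v' s).IsHomogeneous 2) →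
        perPoly (Fin 4) ℂ ≠ ∑ s, v s * v' s := by
  intro b hb i₀ i₁ hi v v' hv hv2 hv' hv'2
  refine caseA_zero two_ne_zero b hb i₀ i₁ hi v v' (fun s => ?_) hv2 (fun s => ?_) hv'2
  · simpa only [Ideal.span_insert_zero] using hv s
  · simpa only [Ideal.span_insert_zero] using hv' s

end Summit.ValiantsHypothesis.LiftNullstellensatz

end
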